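import Summits.RiemannHypothesis.RiemannHypothesis.Theorems.HandoffSemilocalOddBump
import Summits.RiemannHypothesis.RiemannHypothesis.Theorems.HandoffWallMotion
import HarnessLib

/-!
# HANDOFF — the RH-free WALL CEILING `a*(S) < (log N)/2 + C·(log N)/√N` for every finite `S ⊆ [0, N)`, and what it does to the wall sequence (rh-explicit, track «HANDOFF», seat prove-2 gen5, ATTEMPT-12, part 2/2)

HONEST FRAMING. Nothing here bears on the truth of RH. The cell's WALL SEQUENCE is `W(N) := a*({p < N}) =
weilSemilocalThreshold (Nat.primesBelow N)` (theory-1, `HandoffWallSequence.lean`): the largest window on which the semi-local Weil form of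
the primes below `N` is non-negative; `δ*(q) = W(q) − (log q)/2` is the wall offset (`HandoffMarginLaw.wallOffset`). The tree knows the LOWER
side `RH → (log N)/2 ≤ W(N)` (`log_half_le_wall_of_riemannHypothesis`), the rate-free criteria `RH ↔ W → ∞ ↔ δ* bounded below`
(`HandoffWallSequence` / `HandoffWallMotion`), kernel UPPER clauses `W(q) < (log q⁺)/2` for `q ≤ 13` (`HandoffUpperClauses.lean`), and for a
general finite `S` only the qualitative bound `a*(S) ≤ threshold S + 1 ≍ Σ_{p∈S} log p/√p` (`WeilSemilocalEventuallyNegative.lean`, i.e.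
`W(N) ≲ √N`). This file proves the first UPPER bound with the right leading term, and reads it off for the wall sequence:

* §1 **THE WALL CEILING** `weilSemilocalThreshold_lt_ceiling` (RH-free): for every finite `S` all of whose members are `< N`, `N ≥ 10⁷`,
  `cramerGapConst·log N ≤ √N`:  **`a*(S) < (log N)/2 + (cramerGapConst/4)·(log N)/√N`**. Witness: gen2/gen3's odd two-bump
  (`HandoffCramer.lean` used it on «Weil's form + an actual prime gap»; here on «truncated form + the virtual gap above N»), with the
  semi-local machinery of part 1 (`HandoffSemilocalOddBump.lean`): the polar mass `2|f̂(1)|² > 2√N e^{−1} r²` of a bump of radius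
  `r = (cramerGapConst/8)(log N)/√N` sitting on `[(log N)/2, (log N)/2 + 2r]` is paid for, in Weil's form, by the primes in `(N, N e^{4r})`;
  `S` has none of them, and what it does have on that lag range (higher powers of its members, `≤ 3√N` in `Λ`-mass, plus the archimedean tail,
  together `≤ 6.1‖f‖₂²`) and the bumps' own energy `(log(1/r) + cramerEnergyConst)‖f‖₂²` fall short. `cramerGapConst ≥ 1` is gen2's symbolic
  constant (it carries `‖φ₀‖₂²` and a log-moment of Mathlib's unspecified bump), so the side condition `cramerGapConst·log N ≤ √N` is kept
  explicit; it holds for all large `N` (`eventually_cramerGapConst_mul_log_le_sqrt`).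
* §2 CONSEQUENCES (RH-free unless RH is a hypothesis): `wall_lt_ceiling` / `exists_forall_wall_lt_ceiling` (`W(N)` for every large `N`);
  `wallOffset_lt_ceiling`: `δ*(N) < (cramerGapConst/4)(log N)/√N`, and `exists_forall_wallOffset_lt`: `δ*(N) < ε` for all large `N`;
  **every margin law is capped**: `HandoffMargin m → m q < (cramerGapConst/4)(log q)/√q`, in particular `not_handoffMargin_const_of_pos`:
  `MARGIN(c)` is FALSE for every constant `c > 0` (theory-1: `MARGIN(c) ↔ RH` for `c ≤ 0`; conj-1's MARGIN-LAW candidate `m(q) ≈ 0.1/(w_q q²)`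
  — DATA — lives far below the cap); under RH the TWO-SIDED pinning `wallOffset_mem_Ico_of_riemannHypothesis`: `0 ≤ δ*(N) < C(log N)/√N`;
  the criterion **`riemannHypothesis_iff_wallOffset_tendsto_zero : RH ↔ δ*(q) → 0 along the primes`** (the ceiling + theory-1's
  `riemannHypothesis_iff_wallOffset_bddBelow`; with the unconditional dichotomy: the offsets tend to `0⁺` or to `−∞`, no third behaviour —
  a REFORMULATION of RH, not a discount); and the RH-free UPPER CLAUSE FROM A LARGE GAP `wall_lt_log_half_of_large_gap`:
  `q⁺ − q ≥ cramerGapConst·√q·log q → W(q) < (log q⁺)/2` — the complement of gen2's `gap_le_of_edgeNonnegOdd`.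

METHOD BARRIER (ATTEMPT-12 §3, a remark): edge-localised witnesses cannot see below the Cramér scale `(log N)/√N` (a lobe of radius `r` costs
`log(1/r)` of archimedean energy; gen3's `edgeNonnegOdd_sharp_classification` is the matching bound for the family), while the true offsets are
`δ*(q) ≈ 0.106/(w_q·q(q−1))` (cell DATA): the per-prime upper clause `W(q) < (log q⁺)/2` for ALL `q` stays open.

References: E. Bombieri, Rend. Mat. Acc. Lincei (9) 11 (2000), Thm 2 / Lemma 2 (`Bombieri2000Weil`); H. Yoshida, Adv. Stud. Pure Math. 21 (1992)
Prop. 6 p. 320 (`Yoshida1992HermitianForms`, thresholds); A. Connes, C. Consani, Enseign. Math. 69 (2023) 93–148 = arXiv:2106.01715, §2.1.2 (`ConnesConsani2023`, semi-local forms);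
H. Cramér, Ark. Mat. Astr. Fys. 15 (1920) no. 5 (the scale `√x log x`). The ceiling is, as far as searched (ATTEMPT-12 presearch: corpus fts+vec and
galaxy), not in print; it is a theorem about the tree's objects.
-/

set_option linter.dupNamespace false

noncomputable section

open Complex Filter Set MeasureTheory Literature.NumberTheory.LFunctions
  Literature.NumberTheory.LFunctions.WeilContinuous
open Summit.RiemannHypothesis.RiemannHypothesis.Theorems.MotivicDoor.SemilocalThreshold
open Summit.RiemannHypothesis.RiemannHypothesis.Theorems.HandoffMarginLaw (wallOffset HandoffMargin
  riemannHypothesis_iff_forall_wallOffset_nonneg handoffMargin_iff_forall_le_wallOffset)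
open Summit.RiemannHypothesis.RiemannHypothesis.Theorems.HandoffDecomposition (log_half_le_wall_of_riemannHypothesis
  riemannHypothesis_iff_wallOffset_bddBelow)
open Summit.RiemannHypothesis.RiemannHypothesis.Theorems.MotivicDoor.Semilocal (weilSemilocalFunctional_eq_weilFunctional_add)
open Summit.RiemannHypothesis.RiemannHypothesis.Theorems.HandoffSemilocalEnergy (weilSemilocalFunctional_const_mul
  weilSemilocalQuadratic_const_mul)
open Summit.RiemannHypothesis.RiemannHypothesis.Theorems.HandoffSemilocalParitySplit (weilSemilocalFunctional_comp_neg
  weilSemilocalQuadratic_comp_neg weilSemilocalQuadratic_add)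
open scoped Real Topology ComplexConjugate ContDiff ArithmeticFunction.vonMangoldt

namespace Summit.RiemannHypothesis.RiemannHypothesis.Theorems.Handoff

variable {S : Finset ℕ} {q q' N : ℕ}

/-! ## §1 The wall ceiling -/

/-- **THE WALL CEILING (RH-free).** For every finite set `S` of naturals all `< N`, `N ≥ 10⁷`, and `cramerGapConst·log N ≤ √N`:
`a*(S) < (log N)/2 + (cramerGapConst/4)·(log N)/√N` — the semi-local Weil form of `S` is NEGATIVE on the odd two-bump of radius
`r = (cramerGapConst/8)(log N)/√N` sitting on `[(log N)/2, (log N)/2 + 2r]`: its uncompensated polar mass `2|f̂(1)|² > 2√N e^{−1} r²` beats the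
bumps' energy `2(log(1/r) + cramerEnergyConst)‖f‖₂²` plus everything `S` and the archimedean place offer on the lag range `(log N, log N + 4r)`
(`≤ 2·6.1·‖f‖₂²`: higher powers of the members of `S` and the archimedean tail). In Weil's full form the primes in `(N, N e^{4r})` would pay for
the polar mass; `S` has none of them. [this track, ATTEMPT-12 §2; cite: Bombieri2000Weil, Thm 2 / Lemma 2 (the explicit functional)] -/
theorem weilSemilocalThreshold_lt_ceiling (hS : ∀ p ∈ S, p < N) (hN7 : (10 : ℝ) ^ 7 ≤ N)
    (hC : cramerGapConst * Real.log N ≤ Real.sqrt N) :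
    weilSemilocalThreshold S < Real.log N / 2 + cramerGapConst / 4 * Real.log N / Real.sqrt N := by
  have hN0 : (0 : ℝ) < N := lt_of_lt_of_le (by norm_num) hN7
  have h16 : Real.exp 16 ≤ N := exp_sixteen_le.trans hN7
  have hlog16 : (16 : ℝ) ≤ Real.log N := by
    rw [Real.le_log_iff_exp_le hN0]; exact h16
  have hsq : 0 < Real.sqrt N := Real.sqrt_pos.2 hN0
  have hC1 := one_le_cramerGapConst
  have hCpos : 0 < cramerGapConst := lt_of_lt_of_le one_pos hC1
  set r : ℝ := cramerGapConst * Real.log N / (8 * Real.sqrt N) with hr_def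
  have hr : 0 < r := by rw [hr_def]; positivity
  have hr8 : r ≤ 1 / 8 := by
    rw [hr_def, div_le_iff₀ (by positivity)]; linarith only [hC]
  have hr4 : r ≤ 1 / 4 := by linarith only [hr8]
  set c' : ℝ := Real.log N / 2 with hc'_def
  have hc'8 : 8 ≤ c' := by rw [hc'_def]; linarith only [hlog16]
  have hc'pos : 0 < c' := by linarith only [hc'8]
  set x₀ : ℝ := c' + r with hx₀_def
  set b : ℝ := c' + 2 * r with hb_def
  have hcb : c' ≤ b := by rw [hb_def]; linarith only [hr]
  have hb_eq : b = Real.log N / 2 + cramerGapConst / 4 * Real.log N / Real.sqrt N := by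
    rw [hb_def, hc'_def, hr_def]
    field_simp
    ring
  -- `e^{c'} = √N`, `N ≤ e^{2b} = N·e^{4r} ≤ 2N`
  have hexpc' : Real.exp c' = Real.sqrt N := by
    rw [hc'_def, show Real.log N / 2 = Real.log N * (1 / 2) by ring, Real.exp_mul, Real.exp_log hN0,
      Real.sqrt_eq_rpow]
  have hexp2b : Real.exp (2 * b) = N * Real.exp (4 * r) := by
    rw [hb_def, show 2 * (c' + 2 * r) = Real.log N + 4 * r by rw [hc'_def]; ring, Real.exp_add, Real.exp_log hN0]
  have hNb : (N : ℝ) ≤ Real.exp (2 * b) := by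
    rw [hexp2b]
    have h1 : 1 ≤ Real.exp (4 * r) := Real.one_le_exp (by positivity)
    nlinarith only [h1, hN0]
  have h2N : Real.exp (2 * b) ≤ 2 * N := by
    rw [hexp2b]
    have he : Real.exp (4 * r) ≤ Real.exp (1 / 2) := Real.exp_le_exp.2 (by linarith only [hr8])
    have hsq : Real.exp (1 / 2) * Real.exp (1 / 2) = Real.exp 1 := by rw [← Real.exp_add]; norm_num
    have he2 : Real.exp (1 / 2) ≤ 2 := by nlinarith [Real.exp_pos (1 / 2), Real.exp_one_lt_d9]
    nlinarith only [he.trans he2, hN0]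
  -- the witness
  set f := cramerBump r x₀ with hf_def
  have hf : IsWeilTest f := isWeilTest_cramerBump hr x₀
  have hfs : tsupport f ⊆ Icc c' b := by
    refine (tsupport_cramerBump_subset hr x₀).trans (Icc_subset_Icc ?_ ?_)
    · rw [hx₀_def]; linarith only
    · rw [hx₀_def, hb_def]; linarith only
  set F : ℝ → ℂ := fun x ↦ f x - f (-x) with hF_def
  have hF : IsWeilTest F := isWeilTest_sub_comp_neg hf
  have hFs : tsupport F ⊆ Icc (-b) b := tsupport_sub_comp_neg_subset hc'pos.le hcb hfs
  -- the estimates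
  have hE := re_weilSemilocalQuadratic_cramerBump_le S hr hr4 x₀
  have hP := normSq_weilMellin_cramerBump_one_ge hr (by linarith only [hr8]) x₀
  have hNf : ∫ x : ℝ, ‖f x‖ ^ 2 = r * weilNorm2Sq (moll 0) := integral_norm_sq_cramerBump hr x₀
  set Φ := weilNorm2Sq (moll 0) with hΦ
  have hΦ0 : 1 / 2 ≤ Φ := half_le_weilNorm2Sq_moll_zero
  have hΦpos : 0 < Φ := by linarith only [hΦ0]
  have hCE := cramerEnergyConst_nonneg
  -- the lag-range constant: `4M(c')(b − c') + 2·Σ Λ_S(n)/√n ≤ 6.1`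
  set G := ∑ n ∈ Finset.Icc ⌈Real.exp (2 * c')⌉₊ ⌊Real.exp (2 * b)⌋₊, weilSemilocalCoeff S n with hG_def
  have hB : G ≤ 3 := sum_weilSemilocalCoeff_le_three hS hN7 hNb h2N
  have hM : archGapBound c' ≤ 0.002 := by
    unfold archGapBound
    have he : (1000 : ℝ) ≤ Real.exp c' := exp_seven_ge.trans (Real.exp_le_exp.2 (by linarith only [hc'8]))
    have hx : Real.exp (-(4 * c')) ≤ 1 / 2 := by
      have h1 : Real.exp (-(4 * c')) ≤ Real.exp (-1) := Real.exp_le_exp.2 (by linarith only [hc'8])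
      have h2 := Real.exp_neg_one_lt_d9
      linarith only [h1, h2]
    have hden : (500 : ℝ) ≤ Real.exp c' * (1 - Real.exp (-(4 * c'))) := by
      nlinarith only [he, hx, Real.exp_pos c']
    rw [div_le_iff₀ (by linarith only [hden])]
    linarith only [hden]
  have hX : 4 * archGapBound c' * (b - c') + 2 * G ≤ 6.1 := by
    have hM0 : 0 ≤ archGapBound c' := (archGapBound_pos hc'pos).le
    have hbc : b - c' ≤ 1 := by rw [hb_def]; linarith only [hr8]
    have hbc0 : 0 ≤ b - c' := by linarith only [hcb]
    have hprod : archGapBound c' * (b - c') ≤ 0.002 * 1 := mul_le_mul hM hbc hbc0 (by norm_num)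
    linarith only [hprod, hB]
  -- the witness-side bound for the odd two-bump
  have hU := re_weilSemilocalQuadratic_sub_comp_neg_le S hf hc'pos hcb hfs
  -- `e^{x₀ − 1} > √N/e` (strict since `r > 0`)
  have hexp : Real.sqrt N * Real.exp (-1) < Real.exp (x₀ - 1) := by
    have e1 : Real.exp (x₀ - 1) = Real.exp c' * Real.exp r * Real.exp (-1) := by
      rw [hx₀_def, ← Real.exp_add, ← Real.exp_add]; exact congrArg Real.exp (by ring)
    rw [e1, hexpc']
    have h1 : 1 < Real.exp r := Real.one_lt_exp_iff.2 hr
    have h0 : 0 < Real.sqrt N * Real.exp (-1) := by positivity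
    nlinarith only [h1, h0]
  -- `log(1/r) ≤ (log N)/2`
  have hlogr : Real.log (1 / r) ≤ Real.log N / 2 := by
    have h1 : 1 / r ≤ Real.sqrt N := by
      rw [div_le_iff₀ hr, hr_def]
      have e : Real.sqrt N * (cramerGapConst * Real.log N / (8 * Real.sqrt N)) = cramerGapConst * Real.log N / 8 := by
        field_simp
      rw [e]
      have h := mul_le_mul hC1 hlog16 (by norm_num) hCpos.le
      linarith only [h]
    have h2 := Real.log_le_log (by positivity) h1
    rwa [Real.log_sqrt hN0.le] at h2
  -- the key numeric inequality `(log N/2 + C_E + 6.1)·Φ ≤ √N·e^{-1}·r` (this is where `r` was chosen)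
  set A : ℝ := 1 / 2 + (cramerEnergyConst + 6.1) / 16 with hA_def
  have hCdef : cramerGapConst = 8 * Real.exp 1 * Φ * A := by rw [cramerGapConst, hΦ, hA_def]
  have hkey : (Real.log N / 2 + cramerEnergyConst + 6.1) * Φ ≤ Real.sqrt N * Real.exp (-1) * r := by
    have e : Real.sqrt N * Real.exp (-1) * r = Φ * A * Real.log N := by
      rw [hr_def, hCdef, Real.exp_neg]
      have hsqne : Real.sqrt N ≠ 0 := hsq.ne'
      have hene : Real.exp 1 ≠ 0 := (Real.exp_pos 1).ne'
      field_simp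
    rw [e]
    have hE0 : 0 ≤ (cramerEnergyConst + 6.1) / 16 := by
      have : 0 ≤ cramerEnergyConst + 6.1 := by linarith only [hCE]
      exact div_nonneg this (by norm_num)
    have h2 : (cramerEnergyConst + 6.1) / 16 * 16 ≤ (cramerEnergyConst + 6.1) / 16 * Real.log N :=
      mul_le_mul_of_nonneg_left hlog16 hE0
    have h3 : Real.log N / 2 + cramerEnergyConst + 6.1 ≤ A * Real.log N := by
      rw [hA_def]; linarith only [h2]
    calc (Real.log N / 2 + cramerEnergyConst + 6.1) * Φ ≤ (A * Real.log N) * Φ :=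
          mul_le_mul_of_nonneg_right h3 hΦpos.le
      _ = Φ * A * Real.log N := by ring
  -- hence `Re Q_S(F) < 0`
  have hneg : (weilSemilocalQuadratic S F).re < 0 := by
    have h0 : 0 ≤ Complex.normSq (weilMellin f 0) := Complex.normSq_nonneg _
    have hrΦ : 0 ≤ r * Φ := by positivity
    rw [hNf] at hE hU
    have hlr : Real.log (1 / r) + cramerEnergyConst ≤ Real.log N / 2 + cramerEnergyConst := by linarith only [hlogr]
    have hE' : (weilSemilocalQuadratic S f).re ≤ (Real.log N / 2 + cramerEnergyConst) * (r * Φ) :=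
      hE.trans (mul_le_mul_of_nonneg_right hlr hrΦ)
    have hX' : 2 * (4 * archGapBound c' * (b - c') + 2 * G) * (r * Φ) ≤
        2 * 6.1 * (r * Φ) := by nlinarith only [hX, hrΦ]
    have hR0 := mul_lt_mul_of_pos_right hexp (by positivity : (0 : ℝ) < r ^ 2)
    have hR : Real.sqrt N * Real.exp (-1) * r ^ 2 < Complex.normSq (weilMellin f 1) := hR0.trans_le hP
    have hkey' : (Real.log N / 2 + cramerEnergyConst + 6.1) * Φ * r ≤ Real.sqrt N * Real.exp (-1) * r * r :=
      mul_le_mul_of_nonneg_right hkey hr.le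
    have hsum : (weilSemilocalQuadratic S F).re ≤
        2 * ((Real.log N / 2 + cramerEnergyConst) * (r * Φ)) -
          2 * (Complex.normSq (weilMellin f 0) + Complex.normSq (weilMellin f 1)) + 2 * 6.1 * (r * Φ) := by
      linarith only [hU, hE', hX']
    nlinarith only [hsum, hR, hkey', h0]
  -- conclusion
  have hnot : ¬ WeilSemilocalPositivityOn S b := fun hpos ↦ absurd (hpos F hF hFs) (not_le.2 hneg)
  rw [← hb_eq]
  exact not_weilSemilocalPositivityOn_iff_weilSemilocalThreshold_lt.1 hnot

/-! ## §2 Consequences for the wall sequence `W(N) = a*({p < N})` and the wall offsets `δ*(q) = W(q) − (log q)/2` -/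

/-- **The wall sequence under the ceiling (RH-free)**: `W(N) < (log N)/2 + (cramerGapConst/4)(log N)/√N` for every `N ≥ 10⁷` with
`cramerGapConst·log N ≤ √N` (prime or not). [this track, ATTEMPT-12 §3] -/
theorem wall_lt_ceiling (hN7 : (10 : ℝ) ^ 7 ≤ N) (hC : cramerGapConst * Real.log N ≤ Real.sqrt N) :
    weilSemilocalThreshold (Nat.primesBelow N) < Real.log N / 2 + cramerGapConst / 4 * Real.log N / Real.sqrt N :=
  weilSemilocalThreshold_lt_ceiling (fun _ hp ↦ Nat.lt_of_mem_primesBelow hp) hN7 hC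

/-- **Wall-offset ceiling (RH-free)**: `δ*(N) < (cramerGapConst/4)(log N)/√N`. [this track, ATTEMPT-12 §3] -/
theorem wallOffset_lt_ceiling (hN7 : (10 : ℝ) ^ 7 ≤ N) (hC : cramerGapConst * Real.log N ≤ Real.sqrt N) :
    wallOffset N < cramerGapConst / 4 * Real.log N / Real.sqrt N := by
  have h := wall_lt_ceiling hN7 hC
  unfold wallOffset; linarith only [h]

/-- **Two-sided pinning under RH**: `0 ≤ δ*(N) < (cramerGapConst/4)(log N)/√N` — under RH the wall sequence IS `(log N)/2` up to the
Cramér scale. [this track, ATTEMPT-12 §3; cite: Bombieri2000Weil, Thm 2 (RH ⇒ positivity, the lower side)] -/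
theorem wallOffset_mem_Ico_of_riemannHypothesis (hRH : RiemannHypothesis) (hN7 : (10 : ℝ) ^ 7 ≤ N)
    (hC : cramerGapConst * Real.log N ≤ Real.sqrt N) :
    wallOffset N ∈ Ico 0 (cramerGapConst / 4 * Real.log N / Real.sqrt N) := by
  refine ⟨?_, wallOffset_lt_ceiling hN7 hC⟩
  have hN1 : 1 ≤ N := by
    have : (1 : ℝ) ≤ N := le_trans (by norm_num) hN7
    exact_mod_cast this
  have h := log_half_le_wall_of_riemannHypothesis hRH hN1
  unfold wallOffset
  linarith only [h]

/-- **Every margin law is capped (RH-free)**: `MARGIN(m) → m(q) < (cramerGapConst/4)(log q)/√q` for `q ≥ 10⁷` prime with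
`cramerGapConst·log q ≤ √q`. (conj-1's MARGIN-LAW proposes `m(q) ≈ 0.1/(w_q q²)`, DATA — far below this cap.) [this track, ATTEMPT-12 §3] -/
theorem handoffMargin_lt_ceiling {m : ℕ → ℝ} (h : HandoffMargin m) (hq : q.Prime) (hq7 : (10 : ℝ) ^ 7 ≤ q)
    (hC : cramerGapConst * Real.log q ≤ Real.sqrt q) :
    m q < cramerGapConst / 4 * Real.log q / Real.sqrt q := by
  have h1 := h q hq
  have h2 := wall_lt_ceiling hq7 hC
  linarith only [h1, h2]

/-- The side conditions of the ceiling hold for all large `N`, together with any prescribed smallness of the ceiling itself: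
for every `ε > 0`, eventually `10⁷ ≤ N`, `cramerGapConst·log N ≤ √N` and `(cramerGapConst/4)(log N)/√N < ε` (`log x = o(√x)`). [folklore] -/
theorem eventually_ceiling_lt {ε : ℝ} (hε : 0 < ε) :
    ∀ᶠ N : ℕ in atTop, (10 : ℝ) ^ 7 ≤ N ∧ cramerGapConst * Real.log N ≤ Real.sqrt N ∧
      cramerGapConst / 4 * Real.log N / Real.sqrt N < ε := by
  have hC : 0 < cramerGapConst := lt_of_lt_of_le one_pos one_le_cramerGapConst
  have ho := isLittleO_log_rpow_atTop (by norm_num : (0 : ℝ) < 1 / 2)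
  set c : ℝ := min cramerGapConst⁻¹ (2 * ε / cramerGapConst) with hc_def
  have hc : 0 < c := lt_min (inv_pos.2 hC) (by positivity)
  have h1 : ∀ᶠ x : ℝ in atTop, cramerGapConst * Real.log x ≤ Real.sqrt x ∧
      cramerGapConst / 4 * Real.log x / Real.sqrt x < ε := by
    filter_upwards [ho.bound hc, eventually_ge_atTop (1 : ℝ)] with x hx hx1
    have hx0 : 0 < x := by linarith only [hx1]
    rw [Real.norm_of_nonneg (Real.log_nonneg hx1), Real.norm_of_nonneg (by positivity), ← Real.sqrt_eq_rpow] at hx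
    have hsx : 0 < Real.sqrt x := Real.sqrt_pos.2 hx0
    have hc1 : c ≤ cramerGapConst⁻¹ := min_le_left _ _
    have hc2 : c ≤ 2 * ε / cramerGapConst := min_le_right _ _
    constructor
    · calc cramerGapConst * Real.log x ≤ cramerGapConst * (cramerGapConst⁻¹ * Real.sqrt x) :=
            mul_le_mul_of_nonneg_left (hx.trans (mul_le_mul_of_nonneg_right hc1 hsx.le)) hC.le
        _ = Real.sqrt x := by field_simp
    · rw [div_lt_iff₀ hsx]
      have h3 : Real.log x ≤ 2 * ε / cramerGapConst * Real.sqrt x := hx.trans (mul_le_mul_of_nonneg_right hc2 hsx.le)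
      have h4 : cramerGapConst / 4 * (2 * ε / cramerGapConst * Real.sqrt x) = ε / 2 * Real.sqrt x := by
        field_simp
        ring
      calc cramerGapConst / 4 * Real.log x ≤ cramerGapConst / 4 * (2 * ε / cramerGapConst * Real.sqrt x) :=
            mul_le_mul_of_nonneg_left h3 (by positivity)
        _ = ε / 2 * Real.sqrt x := h4
        _ < ε * Real.sqrt x := by nlinarith only [hε, hsx]
  have h2 := (tendsto_natCast_atTop_atTop (R := ℝ)).eventually (h1.and (eventually_ge_atTop ((10 : ℝ) ^ 7)))
  filter_upwards [h2] with N hN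
  exact ⟨hN.2, hN.1.1, hN.1.2⟩

/-- The side condition alone, packaged with a threshold: `∃ N₀, ∀ N ≥ N₀, 10⁷ ≤ N ∧ cramerGapConst·log N ≤ √N`. [folklore] -/
theorem eventually_cramerGapConst_mul_log_le_sqrt :
    ∃ N₀ : ℕ, ∀ N ≥ N₀, (10 : ℝ) ^ 7 ≤ N ∧ cramerGapConst * Real.log N ≤ Real.sqrt N := by
  obtain ⟨N₀, hN₀⟩ := eventually_atTop.1 (eventually_ceiling_lt one_pos)
  exact ⟨N₀, fun N hN ↦ ⟨(hN₀ N hN).1, (hN₀ N hN).2.1⟩⟩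

/-- **The ceiling for all large `N`** (no side condition): `∃ N₀, ∀ N ≥ N₀, W(N) < (log N)/2 + (cramerGapConst/4)(log N)/√N`.
[this track, ATTEMPT-12 §3] -/
theorem exists_forall_wall_lt_ceiling :
    ∃ N₀ : ℕ, ∀ N ≥ N₀,
      weilSemilocalThreshold (Nat.primesBelow N) < Real.log N / 2 + cramerGapConst / 4 * Real.log N / Real.sqrt N := by
  obtain ⟨N₀, hN₀⟩ := eventually_cramerGapConst_mul_log_le_sqrt
  exact ⟨N₀, fun N hN ↦ wall_lt_ceiling (hN₀ N hN).1 (hN₀ N hN).2⟩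

/-- **The wall offsets are eventually below any `ε > 0` (RH-free)**: `∃ N₀, ∀ N ≥ N₀, δ*(N) < ε`. [this track, ATTEMPT-12 §3] -/
theorem exists_forall_wallOffset_lt {ε : ℝ} (hε : 0 < ε) : ∃ N₀ : ℕ, ∀ N ≥ N₀, wallOffset N < ε := by
  obtain ⟨N₀, hN₀⟩ := eventually_atTop.1 (eventually_ceiling_lt hε)
  exact ⟨N₀, fun N hN ↦ (wallOffset_lt_ceiling (hN₀ N hN).1 (hN₀ N hN).2.1).trans (hN₀ N hN).2.2⟩

/-- **No positive constant margin (RH-free)**: `MARGIN(c)` is FALSE for every constant `c > 0` — complementing theory-1's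
`handoffMargin_const_iff` (`c ≤ 0`: `MARGIN(c) ↔ RH`). [this track, ATTEMPT-12 §3] -/
theorem not_handoffMargin_const_of_pos {c : ℝ} (hc : 0 < c) : ¬ HandoffMargin (fun _ ↦ c) := by
  intro h
  obtain ⟨N₀, hN₀⟩ := exists_forall_wallOffset_lt hc
  obtain ⟨q, hQq, hq⟩ := Nat.exists_infinite_primes N₀
  have h1 := (handoffMargin_iff_forall_le_wallOffset.1 h) q hq
  exact absurd h1 (not_le.2 (hN₀ q hQq))

/-- **`RH ↔ THE WALL OFFSETS TEND TO ZERO ALONG THE PRIMES`** (`∀ ε > 0, ∃ q₀, ∀ q ≥ q₀ prime, |δ*(q)| < ε`). The ceiling makes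
`δ*(q) < ε` eventually for free; RH supplies `δ*(q) ≥ 0`; conversely offsets tending to `0` are bounded below, which is RH by theory-1's
`riemannHypothesis_iff_wallOffset_bddBelow`. With the unconditional dichotomy this says: the offsets either tend to `0⁺` (RH) or to `−∞` (¬RH) —
there is no third behaviour. A REFORMULATION, not a discount. [this track, ATTEMPT-12 §3; cite: Yoshida1992HermitianForms, Prop. 6 (p. 320)] -/
theorem riemannHypothesis_iff_wallOffset_tendsto_zero :
    RiemannHypothesis ↔ ∀ ε : ℝ, 0 < ε → ∃ q₀ : ℕ, ∀ q ≥ q₀, q.Prime → |wallOffset q| < ε := by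
  constructor
  · intro hRH ε hε
    obtain ⟨N₀, hN₀⟩ := exists_forall_wallOffset_lt hε
    refine ⟨N₀, fun q hq hqp ↦ abs_lt.2 ⟨?_, hN₀ q hq⟩⟩
    have h0 := riemannHypothesis_iff_forall_wallOffset_nonneg.1 hRH q hqp
    linarith only [h0, hε]
  · intro h
    obtain ⟨q₀, hq₀⟩ := h 1 one_pos
    refine riemannHypothesis_iff_wallOffset_bddBelow.2 ?_
    -- below `q₀` finitely many primes; above, `δ* > −1`
    classical
    let s : Finset ℕ := (Finset.range q₀).filter Nat.Prime
    let C₀ : ℝ := if hs : s.Nonempty then s.inf' hs (fun q ↦ wallOffset q) else 0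
    refine ⟨min (-1) C₀, fun q hq ↦ ?_⟩
    rcases lt_or_ge q q₀ with hlt | hge
    · have hmem : q ∈ s := Finset.mem_filter.2 ⟨Finset.mem_range.2 hlt, hq⟩
      have hs : s.Nonempty := ⟨q, hmem⟩
      have h1 : C₀ ≤ wallOffset q := by
        simp only [C₀, dif_pos hs]
        exact Finset.inf'_le _ hmem
      exact (min_le_right _ _).trans h1
    · have h1 := (abs_lt.1 (hq₀ q hge hq)).1
      exact (min_le_left _ _).trans h1.le

/-- **The RH-free UPPER CLAUSE FROM A LARGE GAP.** For consecutive primes `q < q′` with `q ≥ 10⁷`, `cramerGapConst·log q ≤ √q`: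
`q′ − q ≥ cramerGapConst·√q·log q → W(q) < (log q′)/2` — the old form `{p < q}` dies inside the window of `q` whenever the gap after `q`
has Cramér order; the exact complement of gen2's `gap_le_of_edgeNonnegOdd` (Cramér-order gap ⇒ the odd edge block of Weil's form fails).
[this track, ATTEMPT-12 §3] -/
theorem wall_lt_log_half_of_large_gap (hcons : ConsecutivePrimes q q') (hq7 : (10 : ℝ) ^ 7 ≤ q)
    (hC : cramerGapConst * Real.log q ≤ Real.sqrt q)
    (hgap : cramerGapConst * Real.sqrt q * Real.log q ≤ (q' : ℝ) - q) :
    weilSemilocalThreshold (Nat.primesBelow q) < Real.log q' / 2 := by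
  have hq0 : (0 : ℝ) < q := by exact_mod_cast hcons.1.pos
  have hqq' : (q : ℝ) < q' := by exact_mod_cast hcons.2.2.1
  have hq'0 : (0 : ℝ) < q' := hq0.trans hqq'
  have hsq : 0 < Real.sqrt q := Real.sqrt_pos.2 hq0
  have h1 := wall_lt_ceiling hq7 hC
  -- `(log q′ − log q)/2 ≥ (q′ − q)/(4q) ≥ cramerGapConst·log q/(4√q)`
  have hδ : ((q' : ℝ) - q) / (4 * q) ≤ Real.log q' / 2 - Real.log q / 2 := by
    have hl : Real.log ((q' : ℝ) / q) = Real.log q' - Real.log q := Real.log_div hq'0.ne' hq0.ne'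
    have h2 := Real.one_sub_inv_le_log_of_pos (div_pos hq'0 hq0)
    rw [inv_div, hl] at h2
    have h2q : (q' : ℝ) ≤ 2 * q := by exact_mod_cast hcons.le_two_mul
    have h3 : ((q' : ℝ) - q) / (2 * q) ≤ 1 - q / q' := by
      rw [div_le_iff₀ (by positivity)]
      have e : (1 - (q : ℝ) / q') * (2 * q) = 2 * q * ((q' : ℝ) - q) / q' := by field_simp
      rw [e, le_div_iff₀ hq'0]
      nlinarith only [hqq', hq0, h2q]
    have e2 : ((q' : ℝ) - q) / (4 * q) = (((q' : ℝ) - q) / (2 * q)) / 2 := by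
      field_simp
      ring
    rw [e2]
    linarith only [h2, h3]
  have hkey : cramerGapConst / 4 * Real.log q / Real.sqrt q ≤ ((q' : ℝ) - q) / (4 * q) := by
    have e : cramerGapConst / 4 * Real.log q / Real.sqrt q = (cramerGapConst * Real.sqrt q * Real.log q) / (4 * q) := by
      have hq' : (q : ℝ) = Real.sqrt q * Real.sqrt q := (Real.mul_self_sqrt hq0.le).symm
      rw [div_eq_div_iff (by positivity) (by positivity)]
      nth_rewrite 2 [hq']
      ring
    rw [e]
    exact div_le_div_of_nonneg_right hgap (by positivity)
  linarith only [h1, hδ, hkey]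

/-- The same in positivity language: after a Cramér-order gap the OLD form `{p < q}` is negative somewhere on `C((log q′)/2)` — the handoff
at `q` is then a GENUINE rescue, RH-free (the cell's «upper clause» `UC(q)`, kernel-certified so far only for `q ≤ 13`). [this track, ATTEMPT-12 §3] -/
theorem not_weilSemilocalPositivityOn_of_large_gap (hcons : ConsecutivePrimes q q') (hq7 : (10 : ℝ) ^ 7 ≤ q)
    (hC : cramerGapConst * Real.log q ≤ Real.sqrt q)
    (hgap : cramerGapConst * Real.sqrt q * Real.log q ≤ (q' : ℝ) - q) :
    ¬ WeilSemilocalPositivityOn (Nat.primesBelow q) (Real.log q' / 2) :=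
  not_weilSemilocalPositivityOn_iff_weilSemilocalThreshold_lt.2 (wall_lt_log_half_of_large_gap hcons hq7 hC hgap)

end Summit.RiemannHypothesis.RiemannHypothesis.Theorems.Handoff
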